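import Literature.NumberTheory.Sieve.PolymathGEHInnerSum
import Literature.NumberTheory.Sieve.PolymathGEHTypeI
import Literature.NumberTheory.Sieve.PolymathGEHTupleGrid
import HarnessLib

/-!
# Reductions of the level-of-distribution hypothesis for an inner sequence

Trunk AntSieve, tooling toward the named fact `Literature.NumberTheory.Sieve.weakDHL_three_two_of_GEH`
(D. H. J. Polymath, Res. Math. Sci. 1:12 (2014) = arXiv:1407.4897, Theorem 3.2(xii)).

Hypothesis (ii) of `innerSum_divisorSumWeights_asymptotic` (`PolymathGEHInnerSum.lean`) asks for
`Σ_{q ≤ x^ϑ} K^{ω(q)} innerErr(w_x; q) = O(x / log^A x)` for all `K`, `A`, where `innerErr` is the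
maximal discrepancy of `w_x` on `(X₁, X₂]` against the FULL mean.  This file performs the two
reductions of §4.5, p. 17 ("From (divisor-2) we easily obtain the bound … so by Cauchy–Schwarz it
suffices to show (local)" and "Σ₂ ≲ x^{1-ε}"):

* `innerErr_le_iSup_apDiscrepancy_add` — `innerErr ≤ max_a |Δ(w 1_{(X₁,X₂]}; X₂; a (q))| + D_q/φ(q)`
  with `D_q = Σ_{X₁ < m ≤ X₂, (m,q) > 1} |w(m)|` (the discrepancy `Δ` of Claim 2.6 uses the mean over
  `(m, q) = 1`);
* `coprimeDefect_le` — for `w` bounded by `C_w` and supported on `x^ε`-rough numbers,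
  `D_q ≤ C_w ω(q) (X₂ / x^ε + 1)`;
* `isBigO_sum_innerErr_of_apDiscrepancy` — hence the unweighted level bound for `innerErr` follows
  from the one for `max_a |Δ|`;
* `isBigO_sum_pow_omega_mul_innerErr` — Cauchy–Schwarz: the `K^{ω(q)}`-weighted bound follows from
  the unweighted one and the crude bound `innerErr ≤ 5 C_w x / φ(q)`.

## References

* [Polymath8b2014] D. H. J. Polymath, Res. Math. Sci. 1 (2014), Art. 12 = arXiv:1407.4897,
  §4.5, pp. 16–17 ((ll-error1), (ll-error2), (local)).
-/

noncomputable section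

open Finset Filter Asymptotics
open scoped BigOperators ArithmeticFunction.omega

namespace Literature.NumberTheory.Sieve

/-! ### From `innerErr` to the discrepancy of Claim 2.6 -/

/-- The sum of `|w|` over the non-coprime part of the window: `D_q = Σ_{X₁ < m ≤ X₂, (m,q)>1} |w(m)|`. [cite: Polymath8b2014, §4.5, (sp2-def)] -/
def coprimeDefect (w : ℕ → ℝ) (q X₁ X₂ : ℕ) : ℝ :=
  ∑ m ∈ (Ioc X₁ X₂).filter (fun m => ¬ m.Coprime q), |w m|

/-- `D_q ≥ 0`. [folklore] -/
theorem coprimeDefect_nonneg (w : ℕ → ℝ) (q X₁ X₂ : ℕ) : 0 ≤ coprimeDefect w q X₁ X₂ :=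
  Finset.sum_nonneg fun _ _ => abs_nonneg _

/-- **`innerErr` against the discrepancy of Claim 2.6**: for `q ≥ 1` and `1 ≤ X₁ + 1` (automatic),
`innerErr w q X₁ X₂ ≤ max_a |Δ(w 1_{(X₁, ∞)}; X₂; a (q))| + D_q/φ(q)`. [cite: Polymath8b2014, §4.5, (ts) and (sp2-def)] -/
theorem innerErr_le_iSup_apDiscrepancy_add (w : ℕ → ℝ) {q : ℕ} (hq : 1 ≤ q) (X₁ X₂ : ℕ) :
    innerErr w q X₁ X₂ ≤
      (⨆ a : (ZMod q)ˣ, |apDiscrepancy (fun n => if X₁ < n then w n else 0) X₂ q a|) +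
        coprimeDefect w q X₁ X₂ / Nat.totient q := by
  haveI : NeZero q := ⟨by omega⟩
  have hφ0 : (0 : ℝ) < Nat.totient q := by exact_mod_cast Nat.totient_pos.2 (by omega)
  set γ : ℕ → ℝ := fun n => if X₁ < n then w n else 0 with hγ
  have hbdd : BddAbove (Set.range fun a : (ZMod q)ˣ => |apDiscrepancy γ X₂ q a|) :=
    (Set.finite_range _).bddAbove
  -- the window sums as sums over `Icc 1 X₂` of `γ`
  have hwin : ∀ (p : ℕ → Prop) [DecidablePred p],
      ∑ m ∈ (Ioc X₁ X₂).filter p, w m = ∑ n ∈ (Icc 1 X₂).filter p, γ n := by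
    intro p _
    rw [Finset.sum_filter, Finset.sum_filter]
    have hsub : Ioc X₁ X₂ ⊆ Icc 1 X₂ := fun n hn => by
      rw [Finset.mem_Ioc] at hn; rw [Finset.mem_Icc]; omega
    rw [← Finset.sum_subset hsub (f := fun n => if p n then γ n else 0)]
    · refine Finset.sum_congr rfl fun n hn => ?_
      rw [Finset.mem_Ioc] at hn
      simp only [hγ, if_pos hn.1]
    · intro n hn hn'
      rw [Finset.mem_Icc] at hn
      rw [Finset.mem_Ioc, not_and_or] at hn'
      have : ¬ X₁ < n := by omega
      simp only [hγ, if_neg this, ite_self]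
  unfold innerErr
  refine ciSup_le fun a => ?_
  -- the class sum
  have hAP : innerAP w q (a : ZMod q).val X₁ X₂ = ∑ n ∈ (Icc 1 X₂).filter (fun n : ℕ => (n : ZMod q) = a), γ n := by
    unfold innerAP
    rw [hwin]
    refine Finset.sum_congr (Finset.filter_congr fun n _ => ?_) fun _ _ => rfl
    rw [← ZMod.natCast_eq_natCast_iff, ZMod.natCast_val, ZMod.cast_id', id]
  -- the total: coprime part plus defect
  have htot : innerTotal w X₁ X₂ = (∑ n ∈ (Icc 1 X₂).filter (fun n : ℕ => n.Coprime q), γ n) +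
      ∑ m ∈ (Ioc X₁ X₂).filter (fun m => ¬ m.Coprime q), w m := by
    unfold innerTotal
    rw [← hwin, Finset.sum_filter_add_sum_filter_not]
  have hdef : |∑ m ∈ (Ioc X₁ X₂).filter (fun m => ¬ m.Coprime q), w m| ≤ coprimeDefect w q X₁ X₂ :=
    Finset.abs_sum_le_sum_abs _ _
  have hrew : innerAP w q (a : ZMod q).val X₁ X₂ - innerTotal w X₁ X₂ / Nat.totient q =
      apDiscrepancy γ X₂ q a -
        (∑ m ∈ (Ioc X₁ X₂).filter (fun m => ¬ m.Coprime q), w m) / Nat.totient q := by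
    rw [hAP, htot, apDiscrepancy, add_div]
    ring
  rw [hrew]
  calc |apDiscrepancy γ X₂ q a - (∑ m ∈ (Ioc X₁ X₂).filter (fun m => ¬ m.Coprime q), w m) / Nat.totient q|
      ≤ |apDiscrepancy γ X₂ q a| + |(∑ m ∈ (Ioc X₁ X₂).filter (fun m => ¬ m.Coprime q), w m) / Nat.totient q| :=
        abs_sub _ _
    _ ≤ (⨆ a : (ZMod q)ˣ, |apDiscrepancy γ X₂ q a|) + coprimeDefect w q X₁ X₂ / Nat.totient q := by
        refine add_le_add (le_ciSup hbdd a) ?_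
        rw [abs_div, abs_of_pos hφ0]
        exact div_le_div_of_nonneg_right hdef hφ0.le

/-- **The coprime defect for a bounded sequence supported on `z`-rough numbers**: if `|w| ≤ C` and
`w(m) ≠ 0` forces every prime factor of `m` to exceed `z ≥ 1`, then for `q ≥ 1`
`D_q ≤ C ω(q) (X₂/z + 1)` ("the only way that `(n, q)` can exceed `1` is if there is a prime `x^ε < p`
which divides both `n` and one of `d_1,…,d'_{k-1}`", p. 16). [cite: Polymath8b2014, §4.5, (ll-error1)] -/
theorem coprimeDefect_le {w : ℕ → ℝ} {C : ℝ} (hC0 : 0 ≤ C) (hC : ∀ m, |w m| ≤ C) {z : ℝ} (hz : 1 ≤ z)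
    (hrough : ∀ m, w m ≠ 0 → ∀ p : ℕ, p.Prime → p ∣ m → z < p) {q : ℕ} (hq : 1 ≤ q) (X₁ X₂ : ℕ) :
    coprimeDefect w q X₁ X₂ ≤ C * ω q * ((X₂ : ℝ) / z + 1) := by
  classical
  unfold coprimeDefect
  -- only `m` with `w m ≠ 0` count, and each has a prime factor `p ∣ q` with `p > z`
  set S := (Ioc X₁ X₂).filter (fun m => ¬ m.Coprime q) with hS
  have hstep : ∑ m ∈ S, |w m| ≤ ∑ m ∈ S.filter (fun m => w m ≠ 0), C := by
    rw [← Finset.sum_filter_add_sum_filter_not S (fun m => w m ≠ 0)]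
    have h0 : ∑ m ∈ S.filter (fun m => ¬ w m ≠ 0), |w m| = 0 :=
      Finset.sum_eq_zero fun m hm => by
        have := (Finset.mem_filter.1 hm).2
        push Not at this
        rw [this, abs_zero]
    rw [h0, add_zero]
    exact Finset.sum_le_sum fun m _ => hC m
  refine hstep.trans ?_
  rw [Finset.sum_const, nsmul_eq_mul]
  -- count: `S' ⊆ ⋃_{p ∣ q, p > z} {m ≤ X₂ : p ∣ m}`
  set P : Finset ℕ := q.primeFactors.filter (fun p : ℕ => z < (p : ℝ)) with hP
  have hcover : S.filter (fun m => w m ≠ 0) ⊆ P.biUnion fun p => (Icc 1 X₂).filter (fun m : ℕ => p ∣ m) := by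
    intro m hm
    rw [Finset.mem_filter] at hm
    obtain ⟨hmS, hwm⟩ := hm
    rw [hS, Finset.mem_filter, Finset.mem_Ioc] at hmS
    obtain ⟨⟨hm1, hm2⟩, hncop⟩ := hmS
    have hg : 1 < Nat.gcd m q := by
      have h1 : Nat.gcd m q ≠ 1 := hncop
      have h2 : 0 < Nat.gcd m q := Nat.gcd_pos_of_pos_right _ (by omega)
      omega
    obtain ⟨p, hp, hpg⟩ := Nat.exists_prime_and_dvd hg.ne'
    have hpm : p ∣ m := hpg.trans (Nat.gcd_dvd_left m q)
    have hpq : p ∣ q := hpg.trans (Nat.gcd_dvd_right m q)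
    rw [Finset.mem_biUnion]
    refine ⟨p, ?_, ?_⟩
    · rw [hP, Finset.mem_filter, Nat.mem_primeFactors]
      exact ⟨⟨hp, hpq, by omega⟩, hrough m hwm p hp hpm⟩
    · rw [Finset.mem_filter, Finset.mem_Icc]
      exact ⟨⟨by omega, hm2⟩, hpm⟩
  have hcard : ((S.filter (fun m => w m ≠ 0)).card : ℝ) ≤ ω q * ((X₂ : ℝ) / z + 1) := by
    calc ((S.filter (fun m => w m ≠ 0)).card : ℝ)
        ≤ ((P.biUnion fun p => (Icc 1 X₂).filter (fun m : ℕ => p ∣ m)).card : ℝ) := by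
          exact_mod_cast Finset.card_le_card hcover
      _ ≤ ∑ p ∈ P, (((Icc 1 X₂).filter (fun m : ℕ => p ∣ m)).card : ℝ) := by
          exact_mod_cast Finset.card_biUnion_le
      _ ≤ ∑ p ∈ P, ((X₂ : ℝ) / z + 1) := by
          refine Finset.sum_le_sum fun p hp => ?_
          rw [hP, Finset.mem_filter] at hp
          obtain ⟨hpf, hzp⟩ := hp
          have hpp : p.Prime := Nat.prime_of_mem_primeFactors hpf
          have hp0 : (0 : ℝ) < p := by exact_mod_cast hpp.pos
          have hcnt : ((Icc 1 X₂).filter (fun m : ℕ => p ∣ m)).card = X₂ / p := by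
            rw [show Icc 1 X₂ = Ioc 0 X₂ from rfl, Nat.Ioc_filter_dvd_card_eq_div]
          rw [hcnt]
          calc ((X₂ / p : ℕ) : ℝ) ≤ (X₂ : ℝ) / p := Nat.cast_div_le
            _ ≤ (X₂ : ℝ) / z := div_le_div_of_nonneg_left (Nat.cast_nonneg _) (by linarith) hzp.le
            _ ≤ (X₂ : ℝ) / z + 1 := by linarith
      _ = (P.card : ℝ) * ((X₂ : ℝ) / z + 1) := by rw [Finset.sum_const, nsmul_eq_mul]
      _ ≤ ω q * ((X₂ : ℝ) / z + 1) := by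
          refine mul_le_mul_of_nonneg_right ?_ (by positivity)
          have : P.card ≤ ω q := by
            rw [ArithmeticFunction.cardDistinctFactors_apply, ← List.card_toFinset, Nat.toFinset_factors]
            exact Finset.card_le_card (Finset.filter_subset _ _)
          exact_mod_cast this
  calc ((S.filter (fun m => w m ≠ 0)).card : ℝ) * C ≤ (ω q * ((X₂ : ℝ) / z + 1)) * C :=
        mul_le_mul_of_nonneg_right hcard hC0
    _ = C * ω q * ((X₂ : ℝ) / z + 1) := by ring

/-! ### The crude bound -/

/-- **Crude bound**: `|w| ≤ C`, `1 ≤ q`, `X₂ ≤ 3x`, `q ≤ x` give `innerErr w q X₁ X₂ ≤ 7 C x / φ(q)`. [cite: Polymath8b2014, §4.5, p. 17 ("crude estimates on the discrepancy")] -/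
theorem innerErr_le_crude {w : ℕ → ℝ} {C : ℝ} (hC0 : 0 ≤ C) (hC : ∀ m, |w m| ≤ C) {q : ℕ} (hq : 1 ≤ q)
    {X₁ X₂ : ℕ} {x : ℝ} (hX₂ : (X₂ : ℝ) ≤ 3 * x) (hqx : (q : ℝ) ≤ x) :
    innerErr w q X₁ X₂ ≤ 7 * C * x / Nat.totient q := by
  haveI : NeZero q := ⟨by omega⟩
  have hφpos : 0 < Nat.totient q := Nat.totient_pos.2 (by omega)
  have hφ0 : (0 : ℝ) < Nat.totient q := by exact_mod_cast hφpos
  have hφq : (Nat.totient q : ℝ) ≤ q := by exact_mod_cast Nat.totient_le q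
  have hq0 : (0 : ℝ) < q := by exact_mod_cast hq
  have hx1 : 1 ≤ x / Nat.totient q := by
    rw [le_div_iff₀ hφ0]; linarith
  have hx0 : 0 ≤ x := le_trans (by positivity) hqx
  unfold innerErr
  refine ciSup_le fun a => ?_
  -- the class sum
  have h1 : |innerAP w q (a : ZMod q).val X₁ X₂| ≤ C * ((X₂ : ℝ) / q + 1) := by
    unfold innerAP
    refine (Finset.abs_sum_le_sum_abs _ _).trans ?_
    calc ∑ m ∈ (Ioc X₁ X₂).filter (fun m => m ≡ (a : ZMod q).val [MOD q]), |w m|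
        ≤ ∑ m ∈ (Ioc X₁ X₂).filter (fun m => m ≡ (a : ZMod q).val [MOD q]), C :=
          Finset.sum_le_sum fun m _ => hC m
      _ = (((Ioc X₁ X₂).filter (fun m => m ≡ (a : ZMod q).val [MOD q])).card : ℝ) * C := by
          rw [Finset.sum_const, nsmul_eq_mul]
      _ ≤ ((X₂ : ℝ) / q + 1) * C := by
          refine mul_le_mul_of_nonneg_right ?_ hC0
          have hsub : (Ioc X₁ X₂).filter (fun m => m ≡ (a : ZMod q).val [MOD q]) ⊆
              (Icc 1 X₂).filter (fun c : ℕ => (c : ZMod q) = (a : ZMod q)) := by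
            intro m hm
            rw [Finset.mem_filter, Finset.mem_Ioc] at hm
            rw [Finset.mem_filter, Finset.mem_Icc]
            refine ⟨⟨by omega, hm.1.2⟩, ?_⟩
            have := (ZMod.natCast_eq_natCast_iff _ _ _).2 hm.2
            rwa [ZMod.natCast_val, ZMod.cast_id', id] at this
          have hc := (Finset.card_le_card hsub).trans (classCount_le (a : ZMod q) X₂)
          calc (((Ioc X₁ X₂).filter (fun m => m ≡ (a : ZMod q).val [MOD q])).card : ℝ)
              ≤ ((X₂ / q + 1 : ℕ) : ℝ) := by exact_mod_cast hc
            _ = ((X₂ / q : ℕ) : ℝ) + 1 := by push_cast; ring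
            _ ≤ (X₂ : ℝ) / q + 1 := by linarith [Nat.cast_div_le (m := X₂) (n := q) (α := ℝ)]
      _ = C * ((X₂ : ℝ) / q + 1) := by ring
  have h2 : |innerTotal w X₁ X₂| ≤ C * X₂ := by
    unfold innerTotal
    refine (Finset.abs_sum_le_sum_abs _ _).trans ?_
    calc ∑ m ∈ Ioc X₁ X₂, |w m| ≤ ∑ m ∈ Ioc X₁ X₂, C := Finset.sum_le_sum fun m _ => hC m
      _ = ((X₂ - X₁ : ℕ) : ℝ) * C := by rw [Finset.sum_const, nsmul_eq_mul, Nat.card_Ioc]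
      _ ≤ (X₂ : ℝ) * C := by
          refine mul_le_mul_of_nonneg_right ?_ hC0
          exact_mod_cast Nat.sub_le X₂ X₁
      _ = C * X₂ := by ring
  calc |innerAP w q (a : ZMod q).val X₁ X₂ - innerTotal w X₁ X₂ / Nat.totient q|
      ≤ |innerAP w q (a : ZMod q).val X₁ X₂| + |innerTotal w X₁ X₂| / Nat.totient q := by
        have := abs_sub (innerAP w q (a : ZMod q).val X₁ X₂) (innerTotal w X₁ X₂ / Nat.totient q)
        rwa [abs_div, abs_of_pos hφ0] at this
    _ ≤ C * ((X₂ : ℝ) / q + 1) + C * X₂ / Nat.totient q :=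
        add_le_add h1 (div_le_div_of_nonneg_right h2 hφ0.le)
    _ ≤ C * (3 * x / Nat.totient q + x / Nat.totient q) + C * (3 * x) / Nat.totient q := by
        have h3 : (X₂ : ℝ) / q ≤ 3 * x / Nat.totient q :=
          calc (X₂ : ℝ) / q ≤ 3 * x / q := div_le_div_of_nonneg_right hX₂ hq0.le
            _ ≤ 3 * x / Nat.totient q := div_le_div_of_nonneg_left (by linarith) hφ0 hφq
        have h4 : C * X₂ / Nat.totient q ≤ C * (3 * x) / Nat.totient q :=
          div_le_div_of_nonneg_right (mul_le_mul_of_nonneg_left hX₂ hC0) hφ0.le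
        nlinarith [mul_le_mul_of_nonneg_left h3 hC0, mul_le_mul_of_nonneg_left hx1 hC0]
    _ = 7 * C * x / Nat.totient q := by ring

/-! ### From the discrepancy of Claim 2.6 to `innerErr`, in the level sum -/

/-- **Reduction (Σ₂)**: for `w_x` bounded and supported on `x^ε`-rough numbers, the level bound for
`innerErr` follows from the level bound for `max_a |Δ(w_x 1_{(X₁,X₂]}; X₂; a (q))|`; the difference is
`Σ_{q ≤ x^θ} D_q/φ(q) ≪ x^{1-ε} log^{O(1)} x` ("Σ₂ ≲ x^{1-ε}", (ll-error1)). [cite: Polymath8b2014, §4.5, (ll-error1)] -/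
theorem isBigO_sum_innerErr_of_apDiscrepancy {θ : ℝ} (hθ1 : θ ≤ 1) (h₀ : ℤ) {w : ℝ → ℕ → ℝ}
    {Cw : ℝ} (hCw0 : 0 ≤ Cw) (hCw : ∀ᶠ x in atTop, ∀ m, |w x m| ≤ Cw) {ε : ℝ} (hε : 0 < ε) (hε1 : ε ≤ 1)
    (hrough : ∀ᶠ x in atTop, ∀ m, w x m ≠ 0 → ∀ p : ℕ, p.Prime → p ∣ m → x ^ ε < p)
    (hΔ : ∀ A : ℝ, 0 < A → (fun x : ℝ => ∑ q ∈ Icc 1 ⌊x ^ θ⌋₊, ⨆ a : (ZMod q)ˣ,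
        |apDiscrepancy (fun n => if thetaX1 h₀ x < n then w x n else 0) (thetaX2 h₀ x) q a|) =O[atTop]
        fun x : ℝ => x / Real.log x ^ A)
    {A : ℝ} (hA : 0 < A) :
    (fun x : ℝ => ∑ q ∈ Icc 1 ⌊x ^ θ⌋₊, innerErr (w x) q (thetaX1 h₀ x) (thetaX2 h₀ x)) =O[atTop]
      fun x : ℝ => x / Real.log x ^ A := by
  obtain ⟨C, hCpos, hC⟩ := (hΔ A hA).exists_pos
  rw [IsBigOWith] at hC
  set E : ℝ := 4 * Real.exp 20 * (Cw + 1) with hE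
  have hEpos : 0 < E := by positivity
  refine IsBigO.of_bound (C + 1) ?_
  filter_upwards [hC, hCw, hrough, eventually_ge_atTop ((h₀.natAbs : ℝ) + 3),
    (isLittleO_log_rpow_rpow_atTop (A + 4) hε).def (show (0 : ℝ) < 1 / E by positivity)]
    with x hxC hxw hxr hxP hxlog
  have hx3 : 3 ≤ x := by have := (Nat.cast_nonneg h₀.natAbs : (0 : ℝ) ≤ _); linarith
  have hx0 : 0 < x := by linarith
  have hx1 : 1 ≤ x := by linarith
  obtain ⟨hX₁1, hX₁₂, hX₂3⟩ := thetaX_sizes h₀ (show (h₀.natAbs : ℝ) + 2 ≤ x by linarith)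
  set X₁ := thetaX1 h₀ x
  set X₂ := thetaX2 h₀ x
  set Q := ⌊x ^ θ⌋₊ with hQ
  have hlog1 : 1 ≤ Real.log x := by
    rw [Real.le_log_iff_exp_le hx0]
    have := Real.exp_one_lt_d9
    linarith
  have hlogpos : 0 < Real.log x := by linarith
  have hxε : 0 < x ^ ε := by positivity
  have hz1 : 1 ≤ x ^ ε := Real.one_le_rpow hx1 hε.le
  have hxεx : x ^ ε ≤ x := by
    calc x ^ ε ≤ x ^ (1 : ℝ) := Real.rpow_le_rpow_of_exponent_le hx1 hε1
      _ = x := Real.rpow_one x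
  -- termwise reduction
  have hterm : ∀ q ∈ Icc 1 Q, innerErr (w x) q X₁ X₂ ≤
      (⨆ a : (ZMod q)ˣ, |apDiscrepancy (fun n => if X₁ < n then w x n else 0) X₂ q a|) +
        Cw * ω q * ((X₂ : ℝ) / x ^ ε + 1) / Nat.totient q := by
    intro q hq
    have hq1 : 1 ≤ q := (Finset.mem_Icc.1 hq).1
    have hφ0 : (0 : ℝ) < Nat.totient q := by exact_mod_cast Nat.totient_pos.2 (by omega)
    refine (innerErr_le_iSup_apDiscrepancy_add (w x) hq1 X₁ X₂).trans (add_le_add le_rfl ?_)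
    exact div_le_div_of_nonneg_right (coprimeDefect_le hCw0 hxw hz1 hxr hq1 X₁ X₂) hφ0.le
  -- the defect sum
  have hP : ∑ p ∈ Nat.primesLE Q, (1 : ℝ) / p ≤ Real.log (Real.log x) + 4 := by
    rcases le_or_gt 2 Q with hQ2 | hQ2
    · calc ∑ p ∈ Nat.primesLE Q, (1 : ℝ) / p ≤ Real.log (Real.log Q) + 4 :=
            LFunctions.MertensBound.sum_inv_prime_le Q hQ2
        _ ≤ Real.log (Real.log x) + 4 := by
            have hQx : (Q : ℝ) ≤ x := by
              calc (Q : ℝ) ≤ x ^ θ := Nat.floor_le (by positivity)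
                _ ≤ x ^ (1 : ℝ) := Real.rpow_le_rpow_of_exponent_le hx1 hθ1
                _ = x := Real.rpow_one x
            have hQ1 : (1 : ℝ) < Q := by exact_mod_cast (show 1 < Q by omega)
            have hlogQ : 0 < Real.log Q := Real.log_pos hQ1
            gcongr
    · have hempty : Nat.primesLE Q = ∅ := by
        interval_cases Q
        · exact Nat.primesLE_zero
        · exact Nat.primesLE_one
      rw [hempty, Finset.sum_empty]
      have : 0 ≤ Real.log (Real.log x) := Real.log_nonneg hlog1
      linarith
  have hω : ∀ q, (ω q : ℝ) ≤ (2 : ℝ) ^ ω q := fun q => by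
    have : ω q ≤ 2 ^ ω q := Nat.lt_two_pow_self.le
    exact_mod_cast this
  have hsumω : ∑ q ∈ Icc 1 Q, (ω q : ℝ) / Nat.totient q ≤ Real.exp 20 * Real.log x ^ (4 : ℝ) := by
    calc ∑ q ∈ Icc 1 Q, (ω q : ℝ) / Nat.totient q ≤ ∑ q ∈ Icc 1 Q, (2 : ℝ) ^ ω q / Nat.totient q :=
          Finset.sum_le_sum fun q _ => div_le_div_of_nonneg_right (hω q) (Nat.cast_nonneg _)
      _ ≤ Real.exp (2 * 2 * (∑ p ∈ Nat.primesLE Q, (1 : ℝ) / p + 1)) := sum_pow_omega_div_totient_le (by norm_num) Q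
      _ ≤ Real.exp (2 * 2 * (Real.log (Real.log x) + 5)) := Real.exp_le_exp.2 (by linarith [hP])
      _ = Real.exp 20 * Real.log x ^ (4 : ℝ) := by
          rw [show 2 * 2 * (Real.log (Real.log x) + 5) = 20 + Real.log (Real.log x) * 4 by ring,
            Real.exp_add, Real.rpow_def_of_pos hlogpos]
  have hdefect : ∑ q ∈ Icc 1 Q, Cw * ω q * ((X₂ : ℝ) / x ^ ε + 1) / Nat.totient q ≤ x / Real.log x ^ A := by
    have hfac : ∑ q ∈ Icc 1 Q, Cw * ω q * ((X₂ : ℝ) / x ^ ε + 1) / Nat.totient q =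
        Cw * ((X₂ : ℝ) / x ^ ε + 1) * ∑ q ∈ Icc 1 Q, (ω q : ℝ) / Nat.totient q := by
      rw [Finset.mul_sum]; refine Finset.sum_congr rfl fun q _ => by ring
    rw [hfac]
    -- `X₂/x^ε + 1 ≤ 4x/x^ε`
    have hX : (X₂ : ℝ) / x ^ ε + 1 ≤ 4 * x / x ^ ε := by
      rw [div_add_one hxε.ne', div_le_div_iff_of_pos_right hxε]
      linarith
    -- `E log^{A+4} x ≤ x^ε`
    have hkey : E * Real.log x ^ (A + 4) ≤ x ^ ε := by
      have h := hxlog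
      rw [Real.norm_of_nonneg (Real.rpow_nonneg hlogpos.le _), Real.norm_of_nonneg (Real.rpow_nonneg hx0.le _)] at h
      have := mul_le_mul_of_nonneg_left h hEpos.le
      rwa [← mul_assoc, mul_one_div_cancel hEpos.ne', one_mul] at this
    have hLA : Real.log x ^ (A + 4) = Real.log x ^ A * Real.log x ^ (4 : ℝ) := Real.rpow_add hlogpos _ _
    have hL4 : 0 < Real.log x ^ (4 : ℝ) := Real.rpow_pos_of_pos hlogpos _
    have hLApos : 0 < Real.log x ^ A := Real.rpow_pos_of_pos hlogpos _
    calc Cw * ((X₂ : ℝ) / x ^ ε + 1) * ∑ q ∈ Icc 1 Q, (ω q : ℝ) / Nat.totient q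
        ≤ Cw * (4 * x / x ^ ε) * (Real.exp 20 * Real.log x ^ (4 : ℝ)) :=
          mul_le_mul (mul_le_mul_of_nonneg_left hX hCw0) hsumω
            (Finset.sum_nonneg fun q _ => by positivity) (by positivity)
      _ = (4 * Real.exp 20 * Cw * Real.log x ^ (4 : ℝ)) * x / x ^ ε := by ring
      _ ≤ (4 * Real.exp 20 * Cw * Real.log x ^ (4 : ℝ)) * x / (E * Real.log x ^ (A + 4)) :=
          div_le_div_of_nonneg_left (by positivity) (by positivity) hkey
      _ = (Cw / (Cw + 1)) * (x / Real.log x ^ A) := by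
          rw [hLA, hE]; field_simp
      _ ≤ 1 * (x / Real.log x ^ A) := by
          refine mul_le_mul_of_nonneg_right ?_ (by positivity)
          rw [div_le_one (by linarith)]; linarith
      _ = x / Real.log x ^ A := one_mul _
  -- assemble
  have hS0 : 0 ≤ ∑ q ∈ Icc 1 Q, innerErr (w x) q X₁ X₂ :=
    Finset.sum_nonneg fun q _ => innerErr_nonneg _ _ _ _
  have hΔ0 : 0 ≤ ∑ q ∈ Icc 1 Q, ⨆ a : (ZMod q)ˣ,
      |apDiscrepancy (fun n => if X₁ < n then w x n else 0) X₂ q a| :=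
    Finset.sum_nonneg fun q _ => Real.iSup_nonneg fun _ => abs_nonneg _
  have hxA : 0 ≤ x / Real.log x ^ A := div_nonneg hx0.le (Real.rpow_nonneg hlogpos.le _)
  rw [Real.norm_of_nonneg hΔ0, Real.norm_of_nonneg hxA] at hxC
  rw [Real.norm_of_nonneg hS0, Real.norm_of_nonneg hxA]
  calc ∑ q ∈ Icc 1 Q, innerErr (w x) q X₁ X₂
      ≤ ∑ q ∈ Icc 1 Q, ((⨆ a : (ZMod q)ˣ, |apDiscrepancy (fun n => if X₁ < n then w x n else 0) X₂ q a|) +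
          Cw * ω q * ((X₂ : ℝ) / x ^ ε + 1) / Nat.totient q) := Finset.sum_le_sum hterm
    _ = (∑ q ∈ Icc 1 Q, ⨆ a : (ZMod q)ˣ, |apDiscrepancy (fun n => if X₁ < n then w x n else 0) X₂ q a|) +
          ∑ q ∈ Icc 1 Q, Cw * ω q * ((X₂ : ℝ) / x ^ ε + 1) / Nat.totient q := Finset.sum_add_distrib
    _ ≤ C * (x / Real.log x ^ A) + x / Real.log x ^ A := add_le_add hxC hdefect
    _ = (C + 1) * (x / Real.log x ^ A) := by ring

/-! ### Cauchy–Schwarz: the divisor-weighted level sum -/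

/-- **Reduction (Cauchy–Schwarz)** ("From (divisor-2) … by Cauchy–Schwarz it suffices to show
(local)"): for `w_x` bounded, the `K^{ω(q)}`-weighted level bound for `innerErr` follows from the
unweighted one. [cite: Polymath8b2014, §4.5, p. 17] -/
theorem isBigO_sum_pow_omega_mul_innerErr {θ : ℝ} (hθ1 : θ ≤ 1) (h₀ : ℤ) {w : ℝ → ℕ → ℝ}
    {Cw : ℝ} (hCw0 : 0 ≤ Cw) (hCw : ∀ᶠ x in atTop, ∀ m, |w x m| ≤ Cw)
    (hlev : ∀ A : ℝ, 0 < A →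
      (fun x : ℝ => ∑ q ∈ Icc 1 ⌊x ^ θ⌋₊, innerErr (w x) q (thetaX1 h₀ x) (thetaX2 h₀ x)) =O[atTop]
        fun x : ℝ => x / Real.log x ^ A)
    {K : ℝ} (hK : 0 ≤ K) {A : ℝ} (hA : 0 < A) :
    (fun x : ℝ => ∑ q ∈ Icc 1 ⌊x ^ θ⌋₊, K ^ ω q * innerErr (w x) q (thetaX1 h₀ x) (thetaX2 h₀ x))
      =O[atTop] fun x : ℝ => x / Real.log x ^ A := by
  set c := K ^ 2 with hc
  have hc0 : 0 ≤ c := by positivity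
  have h2 := hlev (2 * A + 2 * c) (by positivity)
  obtain ⟨C, hCpos, hC⟩ := h2.exists_pos
  rw [IsBigOWith] at hC
  set B := 7 * (Cw + 1) * Real.exp (2 * c * 5) * C with hB
  have hB0 : 0 ≤ B := by positivity
  refine IsBigO.of_bound (Real.sqrt B) ?_
  filter_upwards [hC, hCw, eventually_ge_atTop ((h₀.natAbs : ℝ) + 3)] with x hCx hxw hxP
  have hx3 : 3 ≤ x := by have := (Nat.cast_nonneg h₀.natAbs : (0 : ℝ) ≤ _); linarith
  have hx0 : 0 < x := by linarith
  have hx1 : 1 ≤ x := by linarith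
  obtain ⟨hX₁1, hX₁₂, hX₂3⟩ := thetaX_sizes h₀ (show (h₀.natAbs : ℝ) + 2 ≤ x by linarith)
  set X₁ := thetaX1 h₀ x
  set X₂ := thetaX2 h₀ x
  have hlog1 : 1 ≤ Real.log x := by
    rw [Real.le_log_iff_exp_le hx0]
    have := Real.exp_one_lt_d9
    linarith
  have hlogpos : 0 < Real.log x := by linarith
  set Q := ⌊x ^ θ⌋₊ with hQ
  have hQx : (Q : ℝ) ≤ x := by
    calc (Q : ℝ) ≤ x ^ θ := Nat.floor_le (by positivity)
      _ ≤ x ^ (1 : ℝ) := Real.rpow_le_rpow_of_exponent_le hx1 hθ1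
      _ = x := Real.rpow_one x
  have hE0 : ∀ q, 0 ≤ innerErr (w x) q X₁ X₂ := fun q => innerErr_nonneg _ _ _ _
  -- Cauchy–Schwarz
  have hCS : (∑ q ∈ Icc 1 Q, K ^ ω q * innerErr (w x) q X₁ X₂) ^ 2 ≤
      (∑ q ∈ Icc 1 Q, c ^ ω q * innerErr (w x) q X₁ X₂) *
        ∑ q ∈ Icc 1 Q, innerErr (w x) q X₁ X₂ := by
    refine Finset.sum_sq_le_sum_mul_sum_of_sq_le_mul _
      (fun q _ => mul_nonneg (pow_nonneg hc0 _) (hE0 q)) (fun q _ => hE0 q) fun q _ => le_of_eq ?_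
    rw [hc]; ring
  -- bound 1
  have hP : ∑ p ∈ Nat.primesLE Q, (1 : ℝ) / p ≤ Real.log (Real.log x) + 4 := by
    rcases le_or_gt 2 Q with hQ2 | hQ2
    · have hlogQ : 0 < Real.log Q := Real.log_pos (by exact_mod_cast (show 1 < Q by omega))
      calc ∑ p ∈ Nat.primesLE Q, (1 : ℝ) / p ≤ Real.log (Real.log Q) + 4 :=
            LFunctions.MertensBound.sum_inv_prime_le Q hQ2
        _ ≤ Real.log (Real.log x) + 4 := by gcongr
    · have hempty : Nat.primesLE Q = ∅ := by
        interval_cases Q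
        · exact Nat.primesLE_zero
        · exact Nat.primesLE_one
      rw [hempty, Finset.sum_empty]
      have : 0 ≤ Real.log (Real.log x) := Real.log_nonneg hlog1
      linarith
  have hB1 : ∑ q ∈ Icc 1 Q, c ^ ω q * innerErr (w x) q X₁ X₂ ≤
      7 * (Cw + 1) * x * (Real.exp (2 * c * 5) * Real.log x ^ (2 * c)) := by
    calc ∑ q ∈ Icc 1 Q, c ^ ω q * innerErr (w x) q X₁ X₂
        ≤ ∑ q ∈ Icc 1 Q, c ^ ω q * (7 * (Cw + 1) * x / Nat.totient q) := by
          refine Finset.sum_le_sum fun q hq => mul_le_mul_of_nonneg_left ?_ (by positivity)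
          have hq1 : 1 ≤ q := (Finset.mem_Icc.1 hq).1
          have hqQ : q ≤ Q := (Finset.mem_Icc.1 hq).2
          refine (innerErr_le_crude (C := Cw + 1) (by positivity) (fun m => (hxw m).trans (by linarith)) hq1 hX₂3
            (le_trans (by exact_mod_cast hqQ) hQx)).trans (le_of_eq ?_)
          ring
      _ = 7 * (Cw + 1) * x * ∑ q ∈ Icc 1 Q, c ^ ω q / (Nat.totient q : ℝ) := by
          rw [Finset.mul_sum]
          refine Finset.sum_congr rfl fun q _ => by ring
      _ ≤ 7 * (Cw + 1) * x * Real.exp (2 * c * (∑ p ∈ Nat.primesLE Q, (1 : ℝ) / p + 1)) := by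
          gcongr
          exact sum_pow_omega_div_totient_le hc0 Q
      _ ≤ 7 * (Cw + 1) * x * Real.exp (2 * c * (Real.log (Real.log x) + 5)) := by
          gcongr 7 * (Cw + 1) * x * Real.exp (2 * c * ?_)
          linarith
      _ = 7 * (Cw + 1) * x * (Real.exp (2 * c * 5) * Real.log x ^ (2 * c)) := by
          rw [show 2 * c * (Real.log (Real.log x) + 5) = 2 * c * 5 + Real.log (Real.log x) * (2 * c) by
            ring, Real.exp_add, Real.rpow_def_of_pos hlogpos]
  -- bound 2
  have hB2 : ∑ q ∈ Icc 1 Q, innerErr (w x) q X₁ X₂ ≤ C * (x / Real.log x ^ (2 * A + 2 * c)) := by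
    have hnn : 0 ≤ ∑ q ∈ Icc 1 Q, innerErr (w x) q X₁ X₂ := Finset.sum_nonneg fun q _ => hE0 q
    change ‖∑ q ∈ Icc 1 Q, innerErr (w x) q X₁ X₂‖ ≤ C * ‖x / Real.log x ^ (2 * A + 2 * c)‖ at hCx
    rwa [Real.norm_of_nonneg hnn,
      Real.norm_of_nonneg (div_nonneg hx0.le (Real.rpow_nonneg hlogpos.le _))] at hCx
  -- combine
  have hS0 : 0 ≤ ∑ q ∈ Icc 1 Q, K ^ ω q * innerErr (w x) q X₁ X₂ :=
    Finset.sum_nonneg fun q _ => mul_nonneg (pow_nonneg hK _) (hE0 q)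
  have hxA : 0 ≤ x / Real.log x ^ A := div_nonneg hx0.le (Real.rpow_nonneg hlogpos.le _)
  have hR0 : 0 ≤ Real.sqrt B * (x / Real.log x ^ A) := mul_nonneg (Real.sqrt_nonneg _) hxA
  rw [Real.norm_of_nonneg hS0, Real.norm_of_nonneg hxA]
  rw [← pow_le_pow_iff_left₀ hS0 hR0 two_ne_zero]
  have hL1 : Real.log x ^ (2 * A + 2 * c) = Real.log x ^ (2 * A) * Real.log x ^ (2 * c) :=
    Real.rpow_add hlogpos _ _
  have hL2 : (Real.log x ^ A) ^ 2 = Real.log x ^ (2 * A) := by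
    rw [← Real.rpow_natCast, ← Real.rpow_mul hlogpos.le]
    congr 1
    push_cast
    ring
  have hLc : 0 < Real.log x ^ (2 * c) := Real.rpow_pos_of_pos hlogpos _
  have hLA : 0 < Real.log x ^ (2 * A) := Real.rpow_pos_of_pos hlogpos _
  calc (∑ q ∈ Icc 1 Q, K ^ ω q * innerErr (w x) q X₁ X₂) ^ 2
      ≤ (∑ q ∈ Icc 1 Q, c ^ ω q * innerErr (w x) q X₁ X₂) * ∑ q ∈ Icc 1 Q, innerErr (w x) q X₁ X₂ := hCS
    _ ≤ (7 * (Cw + 1) * x * (Real.exp (2 * c * 5) * Real.log x ^ (2 * c))) * (C * (x / Real.log x ^ (2 * A + 2 * c))) :=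
        mul_le_mul hB1 hB2 (Finset.sum_nonneg fun q _ => hE0 q) (by positivity)
    _ = (Real.sqrt B * (x / Real.log x ^ A)) ^ 2 := by
        rw [mul_pow, Real.sq_sqrt hB0, div_pow, hL2, hL1, hB]
        field_simp

end Literature.NumberTheory.Sieve
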